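import Summits.BirchSwinnertonDyer.BirchSwinnertonDyer.Theorems.EisensteinPrimesLocalBalanceAtMultiplicativePlace
import Summits.BirchSwinnertonDyer.BirchSwinnertonDyer.Theorems.EisensteinPrimesLineCharactersWeilRelation
import Summits.BirchSwinnertonDyer.BirchSwinnertonDyer.Theorems.EisensteinPrimesFullDescentMultiplicativeUnipotentLine
import Summits.BirchSwinnertonDyer.Rank1Residual.X2.PrimeOrderCharacters
import HarnessLib

/-!
# Crux 3 `MazurMCOnCellB` (stmt-BirchSwinnertonDyer-19033), line `twistback` v4 — the line characters are
# UNRAMIFIED at every multiplicative place `v ∤ p` (no Tate curve, `ℓ = 2` and non-split included), so the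
# KL-flat door's balance term at such a place is `δ^{(v)} + s_ℓ·[split]` WITHOUT side conditions

Width seat bsd-line-x2-p1-w3 (gen 10), cell `bsd-eis` (run/shared/lean/pub/bsd-eis/), 2026-08-28. HONEST FRAMING: tool
theorems only (no `def`, no named fact, no `sorry`); every input is a tree THEOREM; `--supports`
stmt-BirchSwinnertonDyer-19033; closes no registered stub; no summit statement, no Mazur main conjecture and no BSD is
proved for any curve; 0 cells / labels / tiers move.

WHY. The doors of the sub-row «`p = 3`, non-split, local balance one» (LEAD bsd-line-x2-p1 g11,
`…TwistbackSubrowPartner{,Given,AnyLine}`) take the balance `1 + Σ_{v ∈ S₀} δ_W^{(v)} = Σ_{v ∈ S₀} (s_ℓ[φ(ℓ) = ℓ̄] +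
s_ℓ[ψ(ℓ) = ℓ̄])` RAW. Width seat w7's `…LocalBalanceAtMultiplicativePlace` evaluates the summand at a multiplicative
`v = (ℓ)`, `ℓ ≠ p`, as `δ + s_ℓ` (split) / `δ` (non-split, `ℓ` odd) UNDER the hypotheses `ℓ ∤ m`, `ℓ ∤ d` on the levels of
the primitive characters. Those hypotheses are THEOREMS: at a multiplicative place `v ∤ p` every inertia group acts
UNIPOTENTLY on `E[p]` (width seat x1-p1-w2 g5's `FullDescentMultiplicativeUnipotentLine.smul_smul_sub_eq_of_mem_inertia_geomTorsion`,
from the tree's Tate-curve-free `WeierstrassCurve.smul_smul_sub_eq_of_mem_inertia_of_hasMultiplicativeReductionAt`), hence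
trivially on a stable line and — by the Weil relation `φψ = ω` (w7's `…LineCharactersWeilRelation`) and `ω(I_ℓ) = 1` —
trivially on the quotient; the conductor criterion (`PrimeOrderCharacters.not_dvd_level_of_isPrimitive_of_forall_mem_inertia`)
then gives `ℓ ∤ m`, `ℓ ∤ d`.

* §1 `apply_sub_eq_one_of_mem_inertia`, `apply_quot_eq_one_of_mem_inertia` — `φ(χ_m τ) = ψ(χ_d τ) = 1` for `τ ∈ I_𝔓`,
  `𝔓` any prime of `ℤ̄` above a multiplicative `v ∤ p` (any rational `p`-line, any presenting characters).
* §2 `not_dvd_level_sub_of_hasMultiplicativeReductionAt`, `not_dvd_level_quot_of_hasMultiplicativeReductionAt` — `ℓ ∤ m`,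
  `ℓ ∤ d` for PRIMITIVE presentations (`ℓ = natGenerator v`).
* §3 `balanceTerm_eq_of_hasSplitMultiplicativeReductionAt` / `balanceTerm_eq_of_nonsplit_odd` — w7's two evaluations with
  `hℓm`, `hℓd` DISCHARGED.
* §4 `p = 3`, `ℓ = 2`: `balanceTerm_eq_of_two_three` — at a multiplicative place of residue characteristic `2` (split OR
  non-split) the summand is `δ + s_2·[split]` as well (Weil: `φ(2)ψ(2) = 2̄ = −1`, so exactly one of `φ(2), ψ(2)` is `2̄`;
  `s_2 = 1`; `d_2 = [2 ≡ 1] = 0` split, `[2 ≡ −1] = 1` non-split); `balanceTerm_eq_at_three` — at `p = 3`, for EVERY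
  multiplicative `v ∤ 3` of a globally minimal `W`: summand `= δ_W^{(v)} + (s_ℓ if split, 0 if not)`, no side condition.
* §5 `balance_iff_of_mult_and_other` — summing: over a finite `S₀ ∌ (3)` split as multiplicative places `M` and the rest
  `A`, the door's balance `n + Σ_{S₀} δ = Σ_{S₀} term` reads `n + Σ_{A} δ = Σ_{ℓ ∈ M split} s_ℓ + Σ_{A} term` — the kernel
  form of the desk formula `c(E) = Σ_{ℓ ‖ N, ℓ ≠ 3, split} s_ℓ + (additive terms)` with nothing left to check at the
  multiplicative places.

References: [GreenbergVatsal2000] §2 Prop. (2.4) p. 22, pp. 14–15, p. 27, §3 p. 43; [SilvermanATAEC1994] V.4–V.5,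
Ex. 5.13 (b); [SerreInventiones1972] §1.12; [Washington1997] Ch. 3 (conductors).
-/

set_option autoImplicit false
-- `Summit.BirchSwinnertonDyer.BirchSwinnertonDyer.…`: the summit and its single sub-problem share a name.
set_option linter.dupNamespace false

noncomputable section

open scoped Classical

open NumberField IsDedekindDomain Field WeierstrassCurve
  Literature.NumberTheory.EllipticCurves Literature.NumberTheory.GaloisRepresentations
  Literature.NumberTheory.EllipticCurves.GreenbergSelmer
  Literature.NumberTheory.EllipticCurves.GreenbergVatsal2000
  Literature.NumberTheory.EllipticCurves.Rank1Residual
  Summit.BirchSwinnertonDyer.Rank1Residual.X2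
  Summit.BirchSwinnertonDyer.Rank1Residual.X2.PrimeOrderCharacters
  Summit.BirchSwinnertonDyer.BirchSwinnertonDyer.Theorems.FullDescentMultiplicativeUnipotentLine
  Summit.BirchSwinnertonDyer.BirchSwinnertonDyer.Theorems.EisensteinPrimesLineCharactersWeilRelation
  Summit.BirchSwinnertonDyer.BirchSwinnertonDyer.Theorems.EisensteinPrimesLineCharactersAtMultiplicativePlace
  Summit.BirchSwinnertonDyer.BirchSwinnertonDyer.Theorems.EisensteinPrimesLocalBalanceAtMultiplicativePlace

namespace Summit.BirchSwinnertonDyer.BirchSwinnertonDyer.Theorems.EisensteinPrimesLineCharactersUnramifiedAtMultiplicativePlace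

variable {W : WeierstrassCurve ℚ} [W.IsElliptic] {p : ℕ} [hp : Fact p.Prime]

/-! ## §1. Inertia at a multiplicative `v ∤ p` acts trivially through `φ` and through `ψ` -/

/-- **`φ(χ_m τ) = 1` on inertia at a multiplicative place `v ∤ p`.** For a rational `p`-line `Φ₀ ≤ E[p]` on which
`Γ_ℚ` acts through the Dirichlet character `φ` mod `m` (`hφ0` shape), a place `v` of MULTIPLICATIVE reduction (split or
not) with `v ∤ p`, a prime `𝔓` of `ℤ̄` above `v` and `τ ∈ I_𝔓`: `φ(χ_m(τ)) = 1` — inertia is unipotent on `E[p]`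
(`smul_smul_sub_eq_of_mem_inertia_geomTorsion`), hence trivial on a stable line (`lineCharacter_eq_one_of_unipotent`).
[cite: SilvermanATAEC1994, V.4–V.5 and Exercise 5.13 (b)] [cite: SerreInventiones1972, §1.12] -/
theorem apply_sub_eq_one_of_mem_inertia {v : HeightOneSpectrum (𝓞 ℚ)}
    (hmult : W.HasMultiplicativeReductionAt v) (hpv : ((p : ℕ) : 𝓞 ℚ) ∉ v.asIdeal)
    {𝔓 : Ideal (absIntegers (𝓞 ℚ) ℚ)} (h𝔓 : 𝔓 ∈ v.primesAbove)
    {τ : absoluteGaloisGroup ℚ} (hτ : τ ∈ 𝔓.inertia (absoluteGaloisGroup ℚ))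
    {Φ₀ : AddSubgroup (geomTorsion W (p : ℤ))} (hΦ : IsRationalLine W p Φ₀)
    {m : ℕ} [NeZero m] (φ : DirichletCharacter (ZMod p) m)
    (hφ0 : ∀ (σ : absoluteGaloisGroup ℚ), ∀ P ∈ Φ₀,
      σ • P = (φ ((modNCyclotomicCharacter ℚ m σ : (ZMod m)ˣ) : ZMod m)).val • P) :
    φ ((modNCyclotomicCharacter ℚ m τ : (ZMod m)ˣ) : ZMod m) = 1 := by
  -- a non-zero point of the line (`#Φ₀ = p > 1`)
  haveI : Finite Φ₀ := Nat.finite_of_card_ne_zero (by rw [hΦ.1]; exact hp.out.ne_zero)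
  haveI : Nontrivial Φ₀ := Finite.one_lt_card_iff_nontrivial.mp (by rw [hΦ.1]; exact hp.out.one_lt)
  obtain ⟨⟨P, hPΦ⟩, hP⟩ := exists_ne (0 : Φ₀)
  have hP0 : P ≠ 0 := fun h ↦ hP (Subtype.ext h)
  -- the character of the line as a hom `Γ_ℚ → 𝔽_pˣ`
  have hr : ∀ σ : absoluteGaloisGroup ℚ, σ • P =
      ((φ.toUnitHom.comp (modNCyclotomicCharacter ℚ m) σ : (ZMod p)ˣ) : ZMod p).val • P :=
    fun σ ↦ by rw [coe_toUnitHom_comp]; exact hφ0 σ P hPΦ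
  have h := lineCharacter_eq_one_of_unipotent W p hP0 hr
    (smul_smul_sub_eq_of_mem_inertia_geomTorsion W hmult hp.out hpv h𝔓 hτ P)
  rw [← coe_toUnitHom_comp, h, Units.val_one]

/-- The residue characteristic of a place `v ∤ p` does not divide `p`. [folklore] -/
theorem not_natGenerator_dvd {v : HeightOneSpectrum (𝓞 ℚ)} (hpv : ((p : ℕ) : 𝓞 ℚ) ∉ v.asIdeal) :
    ¬ Rat.HeightOneSpectrum.natGenerator v ∣ p := by
  intro h
  have heq : Rat.HeightOneSpectrum.natGenerator v = p :=
    (Nat.prime_dvd_prime_iff_eq (Rat.HeightOneSpectrum.prime_natGenerator v) hp.out).mp h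
  exact hpv (heq ▸ natCast_mem_asIdeal_of_primesEquiv_eq (coe_primesEquiv_eq_natGenerator v))

/-- **`ψ(χ_d τ) = 1` on inertia at a multiplicative place `v ∤ p`** (quotient character): by §1 for `φ`, the Weil
relation `φ(χ_m τ)·ψ(χ_d τ) = χ_p(τ)` (w7's `apply_mul_apply_eq_modNCyclotomicCharacter`) and `χ_p(I_𝔓) = 1` for
`𝔓 ∤ p` (`modNCyclotomicCharacter_eq_one_of_mem_inertia`). [cite: GreenbergVatsal2000, §2 p. 28 (φψ = ω)]
[cite: SilvermanATAEC1994, V.4–V.5 and Exercise 5.13 (b)] -/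
theorem apply_quot_eq_one_of_mem_inertia {v : HeightOneSpectrum (𝓞 ℚ)}
    (hmult : W.HasMultiplicativeReductionAt v) (hpv : ((p : ℕ) : 𝓞 ℚ) ∉ v.asIdeal)
    {𝔓 : Ideal (absIntegers (𝓞 ℚ) ℚ)} (h𝔓 : 𝔓 ∈ v.primesAbove)
    {τ : absoluteGaloisGroup ℚ} (hτ : τ ∈ 𝔓.inertia (absoluteGaloisGroup ℚ))
    {Φ₀ : AddSubgroup (geomTorsion W (p : ℤ))} (hΦ : IsRationalLine W p Φ₀)
    {m : ℕ} [NeZero m] (φ : DirichletCharacter (ZMod p) m)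
    {d : ℕ} [NeZero d] (ψ : DirichletCharacter (ZMod p) d)
    (hφ0 : ∀ (σ : absoluteGaloisGroup ℚ), ∀ P ∈ Φ₀,
      σ • P = (φ ((modNCyclotomicCharacter ℚ m σ : (ZMod m)ˣ) : ZMod m)).val • P)
    (hψ0 : ∀ (σ : absoluteGaloisGroup ℚ) (Q : geomTorsion W (p : ℤ)),
      σ • Q - (ψ ((modNCyclotomicCharacter ℚ d σ : (ZMod d)ˣ) : ZMod d)).val • Q ∈ Φ₀) :
    ψ ((modNCyclotomicCharacter ℚ d τ : (ZMod d)ˣ) : ZMod d) = 1 := by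
  haveI := h𝔓.1
  have hN : ((p : ℕ) : absIntegers (𝓞 ℚ) ℚ) ∉ 𝔓 :=
    Rat.natCast_not_mem_of_mem_primesAbove_of_not_dvd h𝔓 (not_natGenerator_dvd hpv)
  have hW := apply_mul_apply_eq_modNCyclotomicCharacter hΦ φ ψ hφ0 hψ0 τ
  rw [apply_sub_eq_one_of_mem_inertia hmult hpv h𝔓 hτ hΦ φ hφ0, one_mul,
    modNCyclotomicCharacter_eq_one_of_mem_inertia hN hτ, Units.val_one] at hW
  exact hW

/-! ## §2. The levels of primitive presentations are prime to every multiplicative `ℓ ≠ p` -/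

/-- **`ℓ ∤ m`**: the conductor of the (primitive) character of a rational `p`-line is prime to every multiplicative
prime `ℓ ≠ p` of `E` (`ℓ = natGenerator v`; §1 + the conductor criterion
`not_dvd_level_of_isPrimitive_of_forall_mem_inertia`). [cite: Washington1997, Ch. 3 (conductor and ramification)]
[cite: SilvermanATAEC1994, V.4–V.5 and Exercise 5.13 (b)] -/
theorem not_dvd_level_sub_of_hasMultiplicativeReductionAt {v : HeightOneSpectrum (𝓞 ℚ)}
    (hmult : W.HasMultiplicativeReductionAt v) (hpv : ((p : ℕ) : 𝓞 ℚ) ∉ v.asIdeal)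
    {Φ₀ : AddSubgroup (geomTorsion W (p : ℤ))} (hΦ : IsRationalLine W p Φ₀)
    {m : ℕ} [NeZero m] {φ : DirichletCharacter (ZMod p) m} (hφ : φ.IsPrimitive)
    (hφ0 : ∀ (σ : absoluteGaloisGroup ℚ), ∀ P ∈ Φ₀,
      σ • P = (φ ((modNCyclotomicCharacter ℚ m σ : (ZMod m)ˣ) : ZMod m)).val • P) :
    ¬ Rat.HeightOneSpectrum.natGenerator v ∣ m :=
  not_dvd_level_of_isPrimitive_of_forall_mem_inertia hφ (Rat.HeightOneSpectrum.prime_natGenerator v)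
    (natCast_mem_asIdeal_of_primesEquiv_eq (coe_primesEquiv_eq_natGenerator v))
    (adicCompletionPrime_mem_primesAbove ℚ v)
    fun _ hτ ↦ apply_sub_eq_one_of_mem_inertia hmult hpv (adicCompletionPrime_mem_primesAbove ℚ v) hτ hΦ φ hφ0

/-- **`ℓ ∤ d`**: the conductor of the (primitive) quotient character of a rational `p`-line is prime to every
multiplicative prime `ℓ ≠ p` of `E`. [cite: Washington1997, Ch. 3 (conductor and ramification)]
[cite: GreenbergVatsal2000, §2 p. 28 (φψ = ω)] -/
theorem not_dvd_level_quot_of_hasMultiplicativeReductionAt {v : HeightOneSpectrum (𝓞 ℚ)}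
    (hmult : W.HasMultiplicativeReductionAt v) (hpv : ((p : ℕ) : 𝓞 ℚ) ∉ v.asIdeal)
    {Φ₀ : AddSubgroup (geomTorsion W (p : ℤ))} (hΦ : IsRationalLine W p Φ₀)
    {m : ℕ} [NeZero m] (φ : DirichletCharacter (ZMod p) m)
    {d : ℕ} [NeZero d] {ψ : DirichletCharacter (ZMod p) d} (hψ : ψ.IsPrimitive)
    (hφ0 : ∀ (σ : absoluteGaloisGroup ℚ), ∀ P ∈ Φ₀,
      σ • P = (φ ((modNCyclotomicCharacter ℚ m σ : (ZMod m)ˣ) : ZMod m)).val • P)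
    (hψ0 : ∀ (σ : absoluteGaloisGroup ℚ) (Q : geomTorsion W (p : ℤ)),
      σ • Q - (ψ ((modNCyclotomicCharacter ℚ d σ : (ZMod d)ˣ) : ZMod d)).val • Q ∈ Φ₀) :
    ¬ Rat.HeightOneSpectrum.natGenerator v ∣ d :=
  not_dvd_level_of_isPrimitive_of_forall_mem_inertia hψ (Rat.HeightOneSpectrum.prime_natGenerator v)
    (natCast_mem_asIdeal_of_primesEquiv_eq (coe_primesEquiv_eq_natGenerator v))
    (adicCompletionPrime_mem_primesAbove ℚ v)
    fun _ hτ ↦ apply_quot_eq_one_of_mem_inertia hmult hpv (adicCompletionPrime_mem_primesAbove ℚ v) hτ hΦ φ ψ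
      hφ0 hψ0

/-! ## §3. w7's evaluations of the balance term, side conditions discharged -/

/-- **SPLIT multiplicative `v = (ℓ)`, `ℓ ≠ p` (any `ℓ`, `2` included): the door's balance term at `v` is
`δ_W^{(v)} + s_ℓ`**, for every rational `p`-line with PRIMITIVE presenting characters — w7's
`balanceTerm_of_hasSplitMultiplicativeReductionAt` with `ℓ ∤ m`, `ℓ ∤ d` supplied by §2.
[cite: GreenbergVatsal2000, §2 Prop. (2.4) (p. 22), pp. 14–15 and p. 27] -/
theorem balanceTerm_eq_of_hasSplitMultiplicativeReductionAt {v : HeightOneSpectrum (𝓞 ℚ)}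
    (hpv : ((p : ℕ) : 𝓞 ℚ) ∉ v.asIdeal) (hsplit : W.HasSplitMultiplicativeReductionAt v)
    {Φ₀ : AddSubgroup (geomTorsion W (p : ℤ))} (hΦ : IsRationalLine W p Φ₀)
    {m : ℕ} [NeZero m] {φ : DirichletCharacter (ZMod p) m} (hφ : φ.IsPrimitive)
    {d : ℕ} [NeZero d] {ψ : DirichletCharacter (ZMod p) d} (hψ : ψ.IsPrimitive)
    (hφ0 : ∀ (σ : absoluteGaloisGroup ℚ), ∀ P ∈ Φ₀,
      σ • P = (φ ((modNCyclotomicCharacter ℚ m σ : (ZMod m)ˣ) : ZMod m)).val • P)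
    (hψ0 : ∀ (σ : absoluteGaloisGroup ℚ) (Q : geomTorsion W (p : ℤ)),
      σ • Q - (ψ ((modNCyclotomicCharacter ℚ d σ : (ZMod d)ˣ) : ZMod d)).val • Q ∈ Φ₀) :
    ((if φ (Rat.HeightOneSpectrum.natGenerator v : ZMod m) =
          (Rat.HeightOneSpectrum.natGenerator v : ZMod p)
        then sFactor p (Rat.HeightOneSpectrum.natGenerator v) else 0) +
      (if ψ (Rat.HeightOneSpectrum.natGenerator v : ZMod d) =
          (Rat.HeightOneSpectrum.natGenerator v : ZMod p)
        then sFactor p (Rat.HeightOneSpectrum.natGenerator v) else 0)) =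
      delta W p v + sFactor p (Rat.HeightOneSpectrum.natGenerator v) := by
  have hmult : W.HasMultiplicativeReductionAt v := hsplit.1
  have hℓp : Rat.HeightOneSpectrum.natGenerator v ≠ p := fun h ↦ not_natGenerator_dvd hpv (h ▸ dvd_rfl)
  exact balanceTerm_of_hasSplitMultiplicativeReductionAt hℓp hsplit hΦ φ
    (not_dvd_level_sub_of_hasMultiplicativeReductionAt hmult hpv hΦ hφ hφ0) ψ
    (not_dvd_level_quot_of_hasMultiplicativeReductionAt hmult hpv hΦ φ hψ hφ0 hψ0) hφ0 hψ0

/-- **NON-SPLIT multiplicative ODD `v = (ℓ)`, `ℓ ≠ p`, `p` odd, `W` globally minimal: the door's balance term at `v`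
is `δ_W^{(v)}`** — w7's `balanceTerm_of_not_hasSplitMultiplicativeReductionAtPrime` with `ℓ ∤ m`, `ℓ ∤ d` supplied by
§2. [cite: GreenbergVatsal2000, §2 Prop. (2.4) (p. 22), pp. 14–15 and p. 27] [cite: SilvermanAEC2009, VII.5 Prop. 5.1(b)] -/
theorem balanceTerm_eq_of_nonsplit_odd [W.IsGloballyMinimal] (hp2 : p ≠ 2) {v : HeightOneSpectrum (𝓞 ℚ)}
    (hpv : ((p : ℕ) : 𝓞 ℚ) ∉ v.asIdeal) (hℓ2 : Rat.HeightOneSpectrum.natGenerator v ≠ 2)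
    (hmult : W.HasMultiplicativeReductionAt v) (hns : ¬ W.HasSplitMultiplicativeReductionAt v)
    {Φ₀ : AddSubgroup (geomTorsion W (p : ℤ))} (hΦ : IsRationalLine W p Φ₀)
    {m : ℕ} [NeZero m] {φ : DirichletCharacter (ZMod p) m} (hφ : φ.IsPrimitive)
    {d : ℕ} [NeZero d] {ψ : DirichletCharacter (ZMod p) d} (hψ : ψ.IsPrimitive)
    (hφ0 : ∀ (σ : absoluteGaloisGroup ℚ), ∀ P ∈ Φ₀,
      σ • P = (φ ((modNCyclotomicCharacter ℚ m σ : (ZMod m)ˣ) : ZMod m)).val • P)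
    (hψ0 : ∀ (σ : absoluteGaloisGroup ℚ) (Q : geomTorsion W (p : ℤ)),
      σ • Q - (ψ ((modNCyclotomicCharacter ℚ d σ : (ZMod d)ˣ) : ZMod d)).val • Q ∈ Φ₀) :
    ((if φ (Rat.HeightOneSpectrum.natGenerator v : ZMod m) =
          (Rat.HeightOneSpectrum.natGenerator v : ZMod p)
        then sFactor p (Rat.HeightOneSpectrum.natGenerator v) else 0) +
      (if ψ (Rat.HeightOneSpectrum.natGenerator v : ZMod d) =
          (Rat.HeightOneSpectrum.natGenerator v : ZMod p)
        then sFactor p (Rat.HeightOneSpectrum.natGenerator v) else 0)) = delta W p v := by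
  haveI : Fact (Rat.HeightOneSpectrum.natGenerator v).Prime := ⟨Rat.HeightOneSpectrum.prime_natGenerator v⟩
  have hℓp : Rat.HeightOneSpectrum.natGenerator v ≠ p := fun h ↦ not_natGenerator_dvd hpv (h ▸ dvd_rfl)
  have hℓv : ((Rat.HeightOneSpectrum.natGenerator v : ℕ) : 𝓞 ℚ) ∈ v.asIdeal :=
    natCast_mem_asIdeal_of_primesEquiv_eq (coe_primesEquiv_eq_natGenerator v)
  have hmultP : W.HasMultiplicativeReductionAtPrime (Rat.HeightOneSpectrum.natGenerator v) :=
    (W.hasMultiplicativeReductionAtPrime_iff_hasMultiplicativeReductionAt_ringOfIntegers v).mpr hmult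
  have hnsP : ¬ W.HasSplitMultiplicativeReductionAtPrime (Rat.HeightOneSpectrum.natGenerator v) := fun h ↦
    hns ((W.hasSplitMultiplicativeReductionAtPrime_iff_hasSplitMultiplicativeReductionAt v).mp h)
  exact balanceTerm_of_not_hasSplitMultiplicativeReductionAtPrime hp2 hℓp hℓ2 hmultP hnsP hΦ φ
    (not_dvd_level_sub_of_hasMultiplicativeReductionAt hmult hpv hΦ hφ hφ0) ψ
    (not_dvd_level_quot_of_hasMultiplicativeReductionAt hmult hpv hΦ φ hψ hφ0 hψ0) hφ0 hψ0


/-! ## §4. `p = 3`: the place of residue characteristic `2`, and every multiplicative `v ∤ 3` uniformly -/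

/-- In `𝔽₃`, a product `x·y = 2` has exactly one factor equal to `2`. [folklore] -/
theorem eq_two_xor_of_mul_eq_two : ∀ x y : ZMod 3, x * y = 2 → ((x = 2 ∧ y ≠ 2) ∨ (x ≠ 2 ∧ y = 2)) := by
  decide

/-- **`p = 3`, multiplicative `v = (2)` (split OR non-split): the door's balance term at `v` is
`δ_W^{(v)} + s_2·[split]`.** The characters are unramified at `2` (§2), the Weil relation at `a = 2` (w7's
`apply_natCast_mul_apply_natCast`) reads `φ(2)ψ(2) = 2̄` in `𝔽₃`, so exactly one of `φ(2)`, `ψ(2)` equals `2̄` and the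
term is `s_2`; and `δ = s_2·d_2` with `d_2 = [2 ≡ 1 (3)] = 0` (split) resp. `[2 ≡ −1 (3)] = 1` (non-split)
(`X2/LocalDeltaCalculus`). No Tate curve, no parity of `2`. [cite: GreenbergVatsal2000, §2 Prop. (2.4) (p. 22) and p. 28 (φψ = ω)] -/
theorem balanceTerm_eq_of_two_three {v : HeightOneSpectrum (𝓞 ℚ)} (hv2 : Rat.HeightOneSpectrum.natGenerator v = 2)
    (hmult : W.HasMultiplicativeReductionAt v)
    {Φ₀ : AddSubgroup (geomTorsion W (3 : ℤ))} (hΦ : IsRationalLine W 3 Φ₀)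
    {m : ℕ} [NeZero m] {φ : DirichletCharacter (ZMod 3) m} (hφ : φ.IsPrimitive)
    {d : ℕ} [NeZero d] {ψ : DirichletCharacter (ZMod 3) d} (hψ : ψ.IsPrimitive)
    (hφ0 : ∀ (σ : absoluteGaloisGroup ℚ), ∀ P ∈ Φ₀,
      σ • P = (φ ((modNCyclotomicCharacter ℚ m σ : (ZMod m)ˣ) : ZMod m)).val • P)
    (hψ0 : ∀ (σ : absoluteGaloisGroup ℚ) (Q : geomTorsion W (3 : ℤ)),
      σ • Q - (ψ ((modNCyclotomicCharacter ℚ d σ : (ZMod d)ˣ) : ZMod d)).val • Q ∈ Φ₀) :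
    ((if φ (Rat.HeightOneSpectrum.natGenerator v : ZMod m) =
          (Rat.HeightOneSpectrum.natGenerator v : ZMod 3)
        then sFactor 3 (Rat.HeightOneSpectrum.natGenerator v) else 0) +
      (if ψ (Rat.HeightOneSpectrum.natGenerator v : ZMod d) =
          (Rat.HeightOneSpectrum.natGenerator v : ZMod 3)
        then sFactor 3 (Rat.HeightOneSpectrum.natGenerator v) else 0)) =
      delta W 3 v +
        (if W.HasSplitMultiplicativeReductionAt v then sFactor 3 (Rat.HeightOneSpectrum.natGenerator v) else 0) := by
  -- `v ∤ 3`
  have hv3 : ((3 : ℕ) : 𝓞 ℚ) ∉ v.asIdeal := fun h ↦ by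
    have := natGenerator_eq_of_natCast_mem_asIdeal (by norm_num : (3 : ℕ).Prime) h
    omega
  -- the levels are odd
  have h2m : ¬ 2 ∣ m := hv2 ▸ not_dvd_level_sub_of_hasMultiplicativeReductionAt hmult hv3 hΦ hφ hφ0
  have h2d : ¬ 2 ∣ d := hv2 ▸ not_dvd_level_quot_of_hasMultiplicativeReductionAt hmult hv3 hΦ φ hψ hφ0 hψ0
  have hcop : (2 : ℕ).Coprime (3 * m * d) := by
    refine Nat.Coprime.mul_right (Nat.Coprime.mul_right (by norm_num) ?_) ?_
    · exact (Nat.Prime.coprime_iff_not_dvd Nat.prime_two).mpr h2m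
    · exact (Nat.Prime.coprime_iff_not_dvd Nat.prime_two).mpr h2d
  -- Weil at `a = 2`
  have hW : φ ((2 : ℕ) : ZMod m) * ψ ((2 : ℕ) : ZMod d) = ((2 : ℕ) : ZMod 3) :=
    apply_natCast_mul_apply_natCast hΦ φ ψ hφ0 hψ0 hcop
  have h23 : ((2 : ℕ) : ZMod 3) = 2 := rfl
  rw [h23] at hW
  rw [hv2, delta_eq, hv2]
  rcases eq_two_xor_of_mul_eq_two _ _ hW with ⟨hx, hy⟩ | ⟨hx, hy⟩
  · rw [if_pos (hx.trans h23.symm), if_neg (fun h ↦ hy (h.trans h23))]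
    by_cases hsplit : W.HasSplitMultiplicativeReductionAt v
    · rw [if_pos hsplit, LocalDeltaCalculus.dMultiplicity_of_hasSplitMultiplicativeReductionAt hsplit, hv2,
        if_neg (by decide)]
      ring
    · rw [if_neg hsplit, LocalDeltaCalculus.dMultiplicity_of_hasNonsplitMultiplicativeReductionAt hmult hsplit, hv2,
        if_pos (by decide)]
      ring
  · rw [if_neg (fun h ↦ hx (h.trans h23)), if_pos (hy.trans h23.symm)]
    by_cases hsplit : W.HasSplitMultiplicativeReductionAt v
    · rw [if_pos hsplit, LocalDeltaCalculus.dMultiplicity_of_hasSplitMultiplicativeReductionAt hsplit, hv2,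
        if_neg (by decide)]
      ring
    · rw [if_neg hsplit, LocalDeltaCalculus.dMultiplicity_of_hasNonsplitMultiplicativeReductionAt hmult hsplit, hv2,
        if_pos (by decide)]
      ring

/-- **`p = 3`: at EVERY multiplicative place `v ∤ 3` of a globally minimal `W` (any residue characteristic, split or
not) the door's balance term is `δ_W^{(v)} + s_ℓ·[W split at v]`** — for every rational `3`-line with primitive
presenting characters; NO side condition on the levels, no Tate hypothesis. (§3 for split `v` and for non-split odd
`v`, §4 for `v = (2)`.) This is the kernel form of the desk formula «a multiplicative `ℓ ≠ 3` nets `s_ℓ` if split and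
`0` if not» in `c(E)`. [cite: GreenbergVatsal2000, §2 Prop. (2.4) (p. 22), pp. 14–15 and p. 27] -/
theorem balanceTerm_eq_at_three [W.IsGloballyMinimal] {v : HeightOneSpectrum (𝓞 ℚ)}
    (hv3 : ((3 : ℕ) : 𝓞 ℚ) ∉ v.asIdeal) (hmult : W.HasMultiplicativeReductionAt v)
    {Φ₀ : AddSubgroup (geomTorsion W (3 : ℤ))} (hΦ : IsRationalLine W 3 Φ₀)
    {m : ℕ} [NeZero m] {φ : DirichletCharacter (ZMod 3) m} (hφ : φ.IsPrimitive)
    {d : ℕ} [NeZero d] {ψ : DirichletCharacter (ZMod 3) d} (hψ : ψ.IsPrimitive)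
    (hφ0 : ∀ (σ : absoluteGaloisGroup ℚ), ∀ P ∈ Φ₀,
      σ • P = (φ ((modNCyclotomicCharacter ℚ m σ : (ZMod m)ˣ) : ZMod m)).val • P)
    (hψ0 : ∀ (σ : absoluteGaloisGroup ℚ) (Q : geomTorsion W (3 : ℤ)),
      σ • Q - (ψ ((modNCyclotomicCharacter ℚ d σ : (ZMod d)ˣ) : ZMod d)).val • Q ∈ Φ₀) :
    ((if φ (Rat.HeightOneSpectrum.natGenerator v : ZMod m) =
          (Rat.HeightOneSpectrum.natGenerator v : ZMod 3)
        then sFactor 3 (Rat.HeightOneSpectrum.natGenerator v) else 0) +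
      (if ψ (Rat.HeightOneSpectrum.natGenerator v : ZMod d) =
          (Rat.HeightOneSpectrum.natGenerator v : ZMod 3)
        then sFactor 3 (Rat.HeightOneSpectrum.natGenerator v) else 0)) =
      delta W 3 v +
        (if W.HasSplitMultiplicativeReductionAt v then sFactor 3 (Rat.HeightOneSpectrum.natGenerator v) else 0) := by
  by_cases hv2 : Rat.HeightOneSpectrum.natGenerator v = 2
  · exact balanceTerm_eq_of_two_three hv2 hmult hΦ hφ hψ hφ0 hψ0
  by_cases hsplit : W.HasSplitMultiplicativeReductionAt v
  · rw [if_pos hsplit]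
    exact balanceTerm_eq_of_hasSplitMultiplicativeReductionAt hv3 hsplit hΦ hφ hψ hφ0 hψ0
  · rw [if_neg hsplit, add_zero]
    exact balanceTerm_eq_of_nonsplit_odd (by decide) hv3 hv2 hmult hsplit hΦ hφ hψ hφ0 hψ0

/-! ## §5. Summing over `S₀`: nothing is left to check at the multiplicative places -/

/-- **The door's balance with the multiplicative places EVALUATED** (`p = 3`). Let `S₀ ∌ (3)` be a finite set of places
and `A ⊆ S₀` a subset outside which every place of `S₀` is MULTIPLICATIVE for `W` (e.g. `S₀` = the bad places `≠ 3`,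
`A` = the additive ones). Then for every rational `3`-line with primitive presenting characters and every `n`:
`n + Σ_{S₀} δ = Σ_{S₀} term ↔ n + Σ_{A} δ = Σ_{v ∈ S₀ ∖ A} s_ℓ·[W split at v] + Σ_{A} term` — the kernel form of the
desk formula `c(E) = Σ_{ℓ ‖ N, ℓ ≠ 3, split} s_ℓ + (additive terms)`; for the sub-row door `n = 1`. (At an additive
`v ∈ A`, `δ_W^{(v)} = 0` by `LocalDeltaCalculus.delta_of_hasAdditiveReductionAt`, and the term is `0` when both
characters ramify there — w7's `balanceTerm_of_hasAdditiveReductionAt_of_dvd`.)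
[cite: GreenbergVatsal2000, §2 Prop. (2.4) (p. 22) and §3 p. 43] -/
theorem balance_iff_at_three [W.IsGloballyMinimal] {S₀ A : Finset (HeightOneSpectrum (𝓞 ℚ))} (hAS : A ⊆ S₀)
    (hS₀p : ∀ v ∈ S₀, ((3 : ℕ) : 𝓞 ℚ) ∉ v.asIdeal)
    (hmult : ∀ v ∈ S₀, v ∉ A → W.HasMultiplicativeReductionAt v)
    {Φ₀ : AddSubgroup (geomTorsion W (3 : ℤ))} (hΦ : IsRationalLine W 3 Φ₀)
    {m : ℕ} [NeZero m] {φ : DirichletCharacter (ZMod 3) m} (hφ : φ.IsPrimitive)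
    {d : ℕ} [NeZero d] {ψ : DirichletCharacter (ZMod 3) d} (hψ : ψ.IsPrimitive)
    (hφ0 : ∀ (σ : absoluteGaloisGroup ℚ), ∀ P ∈ Φ₀,
      σ • P = (φ ((modNCyclotomicCharacter ℚ m σ : (ZMod m)ˣ) : ZMod m)).val • P)
    (hψ0 : ∀ (σ : absoluteGaloisGroup ℚ) (Q : geomTorsion W (3 : ℤ)),
      σ • Q - (ψ ((modNCyclotomicCharacter ℚ d σ : (ZMod d)ˣ) : ZMod d)).val • Q ∈ Φ₀) (n : ℕ) :
    (n + ∑ v ∈ S₀, delta W 3 v =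
      ∑ v ∈ S₀, ((if φ (Rat.HeightOneSpectrum.natGenerator v : ZMod m) =
            (Rat.HeightOneSpectrum.natGenerator v : ZMod 3)
          then sFactor 3 (Rat.HeightOneSpectrum.natGenerator v) else 0) +
        (if ψ (Rat.HeightOneSpectrum.natGenerator v : ZMod d) =
            (Rat.HeightOneSpectrum.natGenerator v : ZMod 3)
          then sFactor 3 (Rat.HeightOneSpectrum.natGenerator v) else 0))) ↔
    (n + ∑ v ∈ A, delta W 3 v =
      ∑ v ∈ S₀ \ A, (if W.HasSplitMultiplicativeReductionAt v
          then sFactor 3 (Rat.HeightOneSpectrum.natGenerator v) else 0) +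
      ∑ v ∈ A, ((if φ (Rat.HeightOneSpectrum.natGenerator v : ZMod m) =
            (Rat.HeightOneSpectrum.natGenerator v : ZMod 3)
          then sFactor 3 (Rat.HeightOneSpectrum.natGenerator v) else 0) +
        (if ψ (Rat.HeightOneSpectrum.natGenerator v : ZMod d) =
            (Rat.HeightOneSpectrum.natGenerator v : ZMod 3)
          then sFactor 3 (Rat.HeightOneSpectrum.natGenerator v) else 0))) := by
  -- split the sums over `S₀ = (S₀ \ A) ∪ A`
  have hsplitSum : ∀ f : HeightOneSpectrum (𝓞 ℚ) → ℕ,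
      ∑ v ∈ S₀, f v = ∑ v ∈ S₀ \ A, f v + ∑ v ∈ A, f v := fun f ↦ by
    rw [← Finset.sum_sdiff hAS]
  -- evaluate the term on `S₀ \ A`
  have hM : ∑ v ∈ S₀ \ A, ((if φ (Rat.HeightOneSpectrum.natGenerator v : ZMod m) =
            (Rat.HeightOneSpectrum.natGenerator v : ZMod 3)
          then sFactor 3 (Rat.HeightOneSpectrum.natGenerator v) else 0) +
        (if ψ (Rat.HeightOneSpectrum.natGenerator v : ZMod d) =
            (Rat.HeightOneSpectrum.natGenerator v : ZMod 3)
          then sFactor 3 (Rat.HeightOneSpectrum.natGenerator v) else 0)) =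
      ∑ v ∈ S₀ \ A, delta W 3 v +
        ∑ v ∈ S₀ \ A, (if W.HasSplitMultiplicativeReductionAt v
          then sFactor 3 (Rat.HeightOneSpectrum.natGenerator v) else 0) := by
    rw [← Finset.sum_add_distrib]
    refine Finset.sum_congr rfl fun v hv ↦ ?_
    rw [Finset.mem_sdiff] at hv
    exact balanceTerm_eq_at_three (hS₀p v hv.1) (hmult v hv.1 hv.2) hΦ hφ hψ hφ0 hψ0
  rw [hsplitSum (fun v ↦ delta W 3 v), hsplitSum, hM]
  omega

end Summit.BirchSwinnertonDyer.BirchSwinnertonDyer.Theorems.EisensteinPrimesLineCharactersUnramifiedAtMultiplicativePlace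

end
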